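import Summits.QuantumFields.YangMills.Theses.LogConcaveChart
import Literature.Probability.TransportMaps.CaffarelliContraction
import Summits.QuantumFields.YangMills.Theorems.LogConcaveChartTransportSplitGlue
import Summits.QuantumFields.YangMills.Theorems.LogConcaveChartTransportCovarianceTransfer

/-!
# Route `LogConcaveChart` — support item `SandwichTransportMap` (stmt-QuantumFields-23667)
# from the named Literature fact `Caffarelli2000_sandwichBrenierMap`

The child `SandwichTransportMap` of the transport split of crux `QuadraticCovarianceComparison`
(stmt-QuantumFields-26240) is, verbatim, the named Literature fact
`Literature.Probability.TransportMaps.Caffarelli2000_sandwichBrenierMap` (Caffarelli's contraction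
theorem in the two-sided `(1 ± δ)H₀` sandwich form: [Kolesnikov2011, Thm 2.2], [Caffarelli2000,
Thm 11], [Caffarelli1992]; landed p677058).  This file records the BY-NAME link: the item holds
under that fact as a hypothesis (THE MODEL: an unproved published result is a named fact used as a
hypothesis), and conversely — the two are definitionally the same proposition.

HONEST SCOPE. This proves `SandwichTransportMap` only MODULO the cited fact (debt displayed via
closure.modulo; nothing is credited as closed); it proves neither the fact, nor
`QuadraticCovarianceComparison` outright, nor the `LogConcaveChart` thesis, rung R2a
(`BalabanLadder.NT`) or any summit statement; the Yang–Mills mass gap is NOT proved.  Filed by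
ideator seat ym-idea-8 (generation 8, lens «dual»), answering critic note N1 of VERDICT #58.
-/

namespace Summit.QuantumFields.YangMills.Theorems

/-- **`SandwichTransportMap` from the named fact** (item stmt-QuantumFields-23667, modulo
[cite: Caffarelli2000, Thm 11] as typed in `Caffarelli2000_sandwichBrenierMap`). -/
theorem logConcaveChart_sandwichTransportMap_of_caffarelli
    (h : Literature.Probability.TransportMaps.Caffarelli2000_sandwichBrenierMap) :
    Summit.QuantumFields.YangMills.Theses.LogConcaveChart.SandwichTransportMap := h

/-- Conversely the item is exactly the fact (definitional equality), so no strength is hidden in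
the link. [folklore] -/
theorem logConcaveChart_sandwichTransportMap_iff_caffarelli :
    Summit.QuantumFields.YangMills.Theses.LogConcaveChart.SandwichTransportMap ↔
      Literature.Probability.TransportMaps.Caffarelli2000_sandwichBrenierMap := Iff.rfl

/-- **`QuadraticCovarianceComparison` modulo the named fact** (crux stmt-QuantumFields-26240 of
route `LogConcaveChart`, via the proved split: glue `logConcaveChart_transportSplitGlue` and child
`logConcaveChart_transportCovarianceTransfer`). Conditional on [cite: Caffarelli2000, Thm 11] as
typed; credits nothing as closed. -/
theorem logConcaveChart_quadraticCovarianceComparison_of_caffarelli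
    (h : Literature.Probability.TransportMaps.Caffarelli2000_sandwichBrenierMap) :
    Summit.QuantumFields.YangMills.Theses.LogConcaveChart.QuadraticCovarianceComparison :=
  logConcaveChart_transportSplitGlue h logConcaveChart_transportCovarianceTransfer

end Summit.QuantumFields.YangMills.Theorems
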